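import Summits.ResolutionOfSingularities.ResolutionOfSingularities.Theorems.DescentDescentPerfectToAllPerfectBase
import Literature.FieldTheory.Separability.PDegreeSeparablyGenerated
import HarnessLib

/-!
# `DescentPerfectToAll` (stmt-ResolutionOfSingularities-0549): `p`-RANK VERSUS TRANSCENDENCE DEGREE OVER A
# PERFECT SUBFIELD — `p`-independent families are algebraically independent, and the coverage class
# «`p`-rank `≥` transcendence degree over some perfect subfield»

Route `ResolutionOfSingularities/Descent`, crux `DescentPerfectToAll`. Helper (OURS; not a statement of any
manuscript; `--supports` the crux, does not close it).

`DescentDescentPerfectToAllPerfectBase.lean` proves the crux's conclusion (given its antecedent `PerfectRes p`)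
over ground fields `K` ALGEBRAIC over `P(t₁, …, tₙ)` with `P ≤ K` perfect and `t` `p`-independent in `K`. This
file removes the algebraicity hypothesis in favour of the numerical one «`tr.deg_P K ≤ n`», via the classical
fact that `p`-independent elements are algebraically independent over every perfect subfield:

* `linearIndependent_frobenius_monomials` — the `p^n` reduced monomials `t^α` (`α : ι → Fin p`) of a
  `p`-independent family are linearly independent over `K^p = (frobenius K p).fieldRange` (restatement of the
  hypothesis shape `∑_α t^α e_α^p = 0 ⇒ e = 0` used throughout the `DescentDescentPerfectToAll*` files).
* `pIndependent_of_injective` — `p`-independence pulls back along injective ring maps (a family in a subfield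
  `L ≤ K` that is `p`-independent in `K` is `p`-independent in `L`).
* `algebraicIndependent_of_pIndependent_perfect` — **`p`-INDEPENDENT ⇒ ALGEBRAICALLY INDEPENDENT over every
  perfect subfield `P`** (Matsumura, Commutative Ring Theory, Thm. 26.8 and its proof; here by counting: in
  `L = P(t)` the `p^n` monomials are `L^p`-free, so `p^n ≤ [L : L^p] = p^{tr.deg_P L}` by Thm. 26.5
  (tree `exists_finrank_frobenius_eq_pow_card`), while `tr.deg_P L ≤ n`; hence `t` is a transcendence basis of
  `L / P`).
* `isAlgebraic_closure_perfect_range_of_isTranscendenceBasis` — bookkeeping: a transcendence basis `t` of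
  `K / P` makes `K` algebraic over `closure (P ∪ range t)`.
* `exhaustedByEssFiniteType_of_pIndependent_of_trdeg_le`, `hasResolution_of_perfectRes_of_pIndependent_of_trdeg_le`,
  `descentPerfectToAll_pRank_ge_trdeg_perfect` — **resolution over perfect fields ⇒ resolution over every
  ground field `K` having a perfect subfield `P` with `tr.deg_P K ≤ n` and `n` elements `p`-independent in `K`**
  (all dimensions), i.e. «`p`-rank `≥` transcendence degree over some perfect subfield» (then `=`, by
  `card_le_pow_of_linearIndependent_frobenius` below); such fields are EFT-separably exhausted.
* `card_le_pow_of_linearIndependent_frobenius` — **`p`-rank `≤` transcendence degree over a perfect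
  subfield**: if `K` is algebraic over `P(x₁, …, xₙ)`, every `K^p`-linearly independent finite family has at
  most `p^n` members (`[M : M^p] = p^{tr.deg_P M} ≤ p^n` for the finitely generated `M = P(x, v) ∋ v`).

With `descentPerfectToAll_iff_residual` this pins the residual of the crux, among fields of finite transcendence
degree `n` over their perfect core, to those of `p`-rank `< n` (`DescentDescentPerfectToAllPerfectCoreResidual.lean`
proves that such fields are indeed NOT EFT-separably exhausted).
-/

noncomputable section

set_option linter.dupNamespace false -- mandated namespace of this single-conjunct summit

open CategoryTheory CategoryTheory.Limits AlgebraicGeometry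
open Literature.AlgebraicGeometry.Resolution

namespace Summit.ResolutionOfSingularities.ResolutionOfSingularities.Theorems

/-! ## Reduced monomials of a `p`-independent family -/

section Monomials

variable {p : ℕ} [Fact p.Prime] {K : Type} [Field K] [CharP K p] {ι : Type} [Fintype ι] [DecidableEq ι]

/-- **The reduced monomials of a `p`-independent family are `K^p`-linearly independent**: the hypothesis
`∑_α t^α e_α^p = 0 ⇒ e = 0` says exactly that the family `α ↦ ∏ᵢ tᵢ^{αᵢ}` (`α : ι → Fin p`) is linearly
independent over the subfield `K^p = (frobenius K p).fieldRange`. [folklore] -/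
theorem linearIndependent_frobenius_monomials (t : ι → K)
    (ht : ∀ e : (ι → Fin p) → K, ∑ α, (∏ i, t i ^ (α i : ℕ)) * e α ^ p = 0 → ∀ α, e α = 0) :
    LinearIndependent (frobenius K p).fieldRange (fun α : ι → Fin p => ∏ i, t i ^ (α i : ℕ)) := by
  classical
  have hp : p.Prime := Fact.out
  rw [Fintype.linearIndependent_iff]
  intro g hg α
  have hroot : ∀ β, ∃ e : K, e ^ p = (g β : K) := fun β => by
    obtain ⟨e, he⟩ := RingHom.mem_fieldRange.mp (g β).2
    exact ⟨e, by rw [← he, frobenius_def]⟩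
  choose e he using hroot
  have h0 : ∑ β, (∏ i, t i ^ (β i : ℕ)) * e β ^ p = 0 := by
    rw [← hg]
    refine Finset.sum_congr rfl fun β _ => ?_
    rw [he β, Subfield.smul_def, smul_eq_mul, mul_comm]
  have hα := ht e h0 α
  apply Subtype.ext
  rw [ZeroMemClass.coe_zero, ← he α, hα, zero_pow hp.ne_zero]

omit [Fact p.Prime] [CharP K p] in
/-- **`p`-independence pulls back along injective ring maps**: if `f : L → K` is injective and the family
`f ∘ t` is `p`-independent in `K`, then `t` is `p`-independent in `L` (a relation in `L` maps to one in `K`).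
In particular a family lying in a subfield `L ≤ K` that is `p`-independent in `K` is `p`-independent in `L`.
[folklore] -/
theorem pIndependent_of_injective {L : Type} [Field L] (f : L →+* K) (hf : Function.Injective f)
    (tL : ι → L) (t : ι → K) (hft : ∀ i, f (tL i) = t i)
    (ht : ∀ e : (ι → Fin p) → K, ∑ α, (∏ i, t i ^ (α i : ℕ)) * e α ^ p = 0 → ∀ α, e α = 0) :
    ∀ e : (ι → Fin p) → L, ∑ α, (∏ i, tL i ^ (α i : ℕ)) * e α ^ p = 0 → ∀ α, e α = 0 := by
  intro e he α
  have h1 : ∑ β, (∏ i, t i ^ (β i : ℕ)) * f (e β) ^ p = 0 := by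
    have h := congrArg f he
    rw [map_sum, map_zero] at h
    rw [← h]
    refine Finset.sum_congr rfl fun β _ => ?_
    rw [map_mul, map_prod, map_pow]
    simp_rw [map_pow, hft]
  have h2 := ht (fun β => f (e β)) h1 α
  exact hf (by rw [h2, map_zero])

end Monomials

/-! ## `p`-independent ⇒ algebraically independent over a perfect subfield -/

section AlgIndep

variable {p : ℕ} [Fact p.Prime] {K : Type} [Field K] [CharP K p]

variable (p) in
/-- **`p`-independent elements are algebraically independent over every perfect subfield** (Matsumura,
Thm. 26.8: over a perfect ground field a `p`-basis of a finitely generated extension is a separating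
transcendence basis; the independence half, for an arbitrary ambient field). Proof by counting in the finitely
generated field `L = P(t₁, …, tₙ)`: the `p^n` reduced monomials in `t` are `L^p`-free (they are `K^p`-free), so
`p^n ≤ [L : L^p]`; by Matsumura Thm. 26.5 (tree `exists_finrank_frobenius_eq_pow_card`) `[L : L^p] = p^{#s}`
for a transcendence basis `s` of `L / P`, and `#s = tr.deg_P L ≤ n` because `t` generates `L`; so
`tr.deg_P L = n` and the generating family `t` is a transcendence basis of `L / P`.
[cite: Matsumura1987, Thm. 26.5 and Thm. 26.8] -/
theorem algebraicIndependent_of_pIndependent_perfect (P : Subfield K) (hP : ∀ x ∈ P, ∃ y ∈ P, y ^ p = x)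
    {n : ℕ} (t : Fin n → K)
    (ht : ∀ e : (Fin n → Fin p) → K, ∑ α, (∏ i, t i ^ (α i : ℕ)) * e α ^ p = 0 → ∀ α, e α = 0) :
    AlgebraicIndependent P t := by
  classical
  have hp : p.Prime := Fact.out
  haveI := perfectField_subfield_of_forall_exists_pow_eq p P hP
  set L : IntermediateField P K := IntermediateField.adjoin P (Set.range t) with hLdef
  haveI : CharP L p := (algebraMap L K).charP Subtype.val_injective p
  let tL : Fin n → L := fun i => ⟨t i, IntermediateField.subset_adjoin P _ ⟨i, rfl⟩⟩
  have hval : Subtype.val ∘ tL = t := funext fun _ => rfl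
  -- the generators: `P(tL) = ⊤` inside `L`
  have htop : IntermediateField.adjoin P (Set.range tL) = ⊤ := by
    apply IntermediateField.lift_injective L
    rw [IntermediateField.lift_adjoin, IntermediateField.lift_top, ← Set.range_comp, hval]
  haveI : Algebra.EssFiniteType P L :=
    IntermediateField.essFiniteType_iff.mpr ⟨Finset.univ.image t, by
      rw [Finset.coe_image, Finset.coe_univ, Set.image_univ]⟩
  haveI halg : Algebra.IsAlgebraic (Algebra.adjoin P (Set.range tL)) L := by
    rw [← IntermediateField.isAlgebraic_adjoin_iff_top, htop]
    exact ⟨fun x => isAlgebraic_algebraMap (⟨x, IntermediateField.mem_top⟩ : (⊤ : IntermediateField P L))⟩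
  -- `[L : L^p] = p ^ #s` for a transcendence basis `s` of `L / P`
  obtain ⟨s, hs, -, -, hfin⟩ :=
    Literature.FieldTheory.Separability.exists_finrank_frobenius_eq_pow_card (k := P) (K := L) p
  -- the `p^n` monomials in `tL` are `L^p`-free
  have htL := pIndependent_of_injective (algebraMap L K) Subtype.val_injective tL t (fun _ => rfl) ht
  have hli := linearIndependent_frobenius_monomials tL htL
  haveI : Module.Finite (frobenius L p).fieldRange L :=
    Module.finite_of_finrank_pos (by rw [hfin]; exact pow_pos hp.pos _)
  have hcard := hli.fintype_card_le_finrank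
  rw [Fintype.card_fun, Fintype.card_fin, Fintype.card_fin, hfin] at hcard
  have hns : n ≤ s.card := (Nat.pow_le_pow_iff_right hp.two_le).mp hcard
  -- hence `n ≤ tr.deg_P L` and the generating family `tL` is a transcendence basis
  have htr : Cardinal.mk (Fin n) ≤ Algebra.trdeg P L := by
    rw [← hs.cardinalMk_eq_trdeg, Cardinal.mk_coe_finset, Cardinal.mk_fintype, Fintype.card_fin]
    exact_mod_cast hns
  have hB : IsTranscendenceBasis P tL :=
    Algebra.IsAlgebraic.isTranscendenceBasis_of_le_trdeg_of_finite P tL htr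
  -- back to `K`
  have h := hB.1.map (f := L.val) (Set.injOn_of_injective (fun a b h => Subtype.ext h))
  rwa [show (⇑L.val ∘ tL) = t from funext fun _ => rfl] at h

omit [Fact p.Prime] [CharP K p] in
/-- Bookkeeping: if `t` is a transcendence basis of `K` over a subfield `P`, then `K` is algebraic over the
subfield `closure (P ∪ range t) = P(t)` (with its inclusion algebra structure). [folklore] -/
theorem isAlgebraic_closure_perfect_range_of_isTranscendenceBasis (P : Subfield K) {ι : Type} (t : ι → K)
    (hB : IsTranscendenceBasis P t) :
    Algebra.IsAlgebraic (Subfield.closure ((↑P : Set K) ∪ Set.range t)) K := by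
  have halg := hB.isAlgebraic_field
  set K1 := IntermediateField.adjoin P (Set.range t) with hK1
  have hle : K1.toSubfield ≤ Subfield.closure ((↑P : Set K) ∪ Set.range t) :=
    (closure_perfect_range_eq_adjoin_toSubfield P t).symm.le
  letI : Algebra K1 (Subfield.closure ((↑P : Set K) ∪ Set.range t)) :=
    (Subfield.inclusion hle : K1.toSubfield →+* Subfield.closure ((↑P : Set K) ∪ Set.range t)).toAlgebra
  haveI : IsScalarTower K1 (Subfield.closure ((↑P : Set K) ∪ Set.range t)) K :=
    IsScalarTower.of_algebraMap_eq fun _ => rfl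
  exact Algebra.IsAlgebraic.extendScalars (R := K1) (S := Subfield.closure ((↑P : Set K) ∪ Set.range t))
    (Subfield.inclusion hle).injective

end AlgIndep

/-! ## Coverage: `p`-rank `≥` transcendence degree over some perfect subfield -/

/-- **Fields with `tr.deg_P K ≤ n` and `n` `p`-independent elements, `P` a perfect subfield, are EFT-separably
exhausted**: the `p`-independent `t` is algebraically independent over `P`
(`algebraicIndependent_of_pIndependent_perfect`), hence a transcendence basis by the dimension count, so `K` is
algebraic over `P(t)` and `exhaustedByEssFiniteType_of_pIndependent_perfect` applies. [folklore] -/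
theorem exhaustedByEssFiniteType_of_pIndependent_of_trdeg_le {p : ℕ} [Fact p.Prime] {K : Type} [Field K]
    [CharP K p] (P : Subfield K) (hP : ∀ x ∈ P, ∃ y ∈ P, y ^ p = x) {n : ℕ} (t : Fin n → K)
    (ht : ∀ e : (Fin n → Fin p) → K, ∑ α, (∏ i, t i ^ (α i : ℕ)) * e α ^ p = 0 → ∀ α, e α = 0)
    (htr : Algebra.trdeg P K ≤ n) (s : Finset K) :
    ∃ (k₀ : Type) (_ : Field k₀) (_ : PerfectField k₀) (E : Subfield K) (_ : Algebra k₀ E),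
      Algebra.EssFiniteType k₀ E ∧ (↑s : Set K) ⊆ E ∧
        ∀ u : Finset K, LinearIndepOn E _root_.id (↑u : Set K) →
          LinearIndepOn E (fun x : K => x ^ p) (↑u : Set K) := by
  classical
  have hx := algebraicIndependent_of_pIndependent_perfect p P hP t ht
  have hB : IsTranscendenceBasis P t := hx.isTranscendenceBasis_of_trdeg_le_of_finite (by simpa using htr)
  haveI := isAlgebraic_closure_perfect_range_of_isTranscendenceBasis P t hB
  exact exhaustedByEssFiniteType_of_pIndependent_perfect P hP t ht s

/-- **Resolution over perfect fields ⇒ resolution over every ground field of `p`-rank `≥` transcendence degree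
over some perfect subfield**: if `P ≤ K` is perfect, `tr.deg_P K ≤ n` and `t₁, …, tₙ ∈ K` are `p`-independent,
then every reduced separated `K`-scheme of finite type has a resolution, given `PerfectRes p` (all dimensions).
No algebraicity hypothesis: `t` is automatically a transcendence basis of `K / P`. Instances: every field finitely
generated over a perfect field and every separable algebraic extension of one (`p`-rank `=` tr.deg); NOT
`𝔽_p(t, u)`-hulls inside `𝔽_p((t))` (`p`-rank `1 <` tr.deg `2`). [folklore] -/
theorem hasResolution_of_perfectRes_of_pIndependent_of_trdeg_le (p : ℕ) [Fact p.Prime]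
    (H : ∀ (κ : Type) [Field κ] [CharP κ p] [PerfectField κ] (Z : Scheme.{0}) (h : Z ⟶ Spec (.of κ)),
      IsSeparated h → LocallyOfFiniteType h → QuasiCompact h → IsReduced Z → Scheme.HasResolution Z)
    (K : Type) [Field K] [CharP K p] (P : Subfield K) (hP : ∀ x ∈ P, ∃ y ∈ P, y ^ p = x)
    {n : ℕ} (t : Fin n → K)
    (ht : ∀ e : (Fin n → Fin p) → K, ∑ α, (∏ i, t i ^ (α i : ℕ)) * e α ^ p = 0 → ∀ α, e α = 0)
    (htr : Algebra.trdeg P K ≤ n)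
    (X : Scheme.{0}) (f : X ⟶ Spec (.of K)) [IsSeparated f] [LocallyOfFiniteType f] [QuasiCompact f]
    [IsReduced X] : Scheme.HasResolution X := by
  classical
  have hx := algebraicIndependent_of_pIndependent_perfect p P hP t ht
  have hB : IsTranscendenceBasis P t := hx.isTranscendenceBasis_of_trdeg_le_of_finite (by simpa using htr)
  haveI := isAlgebraic_closure_perfect_range_of_isTranscendenceBasis P t hB
  exact hasResolution_of_perfectRes_of_pIndependent_perfect p H K P hP t ht X f

/-- **The «`p`-rank `≥` transcendence degree over a perfect subfield» layer of the crux `DescentPerfectToAll`,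
proved** (binder shape of stmt-0549 with the hypotheses "`P ≤ k` perfect", "`t : Fin n → k` `p`-independent"
and "`Algebra.trdeg P k ≤ n`" inserted). [folklore] -/
theorem descentPerfectToAll_pRank_ge_trdeg_perfect :
    ∀ p : ℕ, p.Prime → (∀ (k : Type) [Field k] [CharP k p] [PerfectField k] (X : Scheme.{0})
      (f : X ⟶ Spec (.of k)), IsSeparated f → LocallyOfFiniteType f → QuasiCompact f →
        IsReduced X → Scheme.HasResolution X) →
    ∀ (k : Type) [Field k] [CharP k p] (P : Subfield k), (∀ x ∈ P, ∃ y ∈ P, y ^ p = x) →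
      ∀ (n : ℕ) (t : Fin n → k),
      (∀ e : (Fin n → Fin p) → k, ∑ α, (∏ i, t i ^ (α i : ℕ)) * e α ^ p = 0 → ∀ α, e α = 0) →
      Algebra.trdeg P k ≤ n →
      ∀ (X : Scheme.{0}) (f : X ⟶ Spec (.of k)),
        IsSeparated f → LocallyOfFiniteType f → QuasiCompact f → IsReduced X →
          Scheme.HasResolution X := by
  intro p hp H k _ _ P hP n t ht htr X f _ _ _ _
  haveI : Fact p.Prime := ⟨hp⟩
  exact hasResolution_of_perfectRes_of_pIndependent_of_trdeg_le p (fun κ _ _ _ Z h a b c d => H κ Z h a b c d)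
    k P hP t ht htr X f

/-! ## `p`-rank `≤` transcendence degree over a perfect subfield -/

/-- **`p`-rank `≤` transcendence degree over a perfect subfield.** If `P ≤ K` is perfect and `K` is algebraic
over `P(x₁, …, xₙ)`, then every finite `K^p`-linearly independent family in `K` has at most `p^n` members: the
family lies in the finitely generated field `M = P(x, v)`, where it is `M^p`-free, and
`[M : M^p] = p^{tr.deg_P M}` (Matsumura Thm. 26.5, tree `exists_finrank_frobenius_eq_pow_card`) with
`tr.deg_P M ≤ tr.deg_P K ≤ n`. [cite: Matsumura1987, Thm. 26.5] -/
theorem card_le_pow_of_linearIndependent_frobenius {p : ℕ} [Fact p.Prime] {K : Type} [Field K] [CharP K p]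
    (P : Subfield K) (hP : ∀ x ∈ P, ∃ y ∈ P, y ^ p = x) {n : ℕ} (x : Fin n → K)
    [Algebra.IsAlgebraic (IntermediateField.adjoin P (Set.range x)) K]
    {m : ℕ} (v : Fin m → K) (hv : LinearIndependent (frobenius K p).fieldRange v) : m ≤ p ^ n := by
  classical
  have hp : p.Prime := Fact.out
  haveI := perfectField_subfield_of_forall_exists_pow_eq p P hP
  -- `tr.deg_P K ≤ n`
  haveI : Algebra.IsAlgebraic (Algebra.adjoin P (Set.range x)) K :=
    IntermediateField.isAlgebraic_adjoin_iff_top.mp inferInstance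
  have htrK : Algebra.trdeg P K ≤ n := by
    refine (Algebra.IsAlgebraic.trdeg_le_cardinalMk P (Set.range x)).trans ?_
    simpa using Cardinal.mk_range_le (f := x)
  -- the finitely generated field `M = P(x, v)`
  set M : IntermediateField P K := IntermediateField.adjoin P (Set.range x ∪ Set.range v) with hMdef
  haveI : CharP M p := (algebraMap M K).charP Subtype.val_injective p
  haveI : Algebra.EssFiniteType P M :=
    IntermediateField.essFiniteType_iff.mpr ⟨Finset.univ.image x ∪ Finset.univ.image v, by
      simp only [Finset.coe_union, Finset.coe_image, Finset.coe_univ, Set.image_univ, hMdef]⟩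
  have htrM : Algebra.trdeg P M ≤ n :=
    (trdeg_le_of_injective M.val fun a b h => Subtype.ext h).trans htrK
  obtain ⟨s, hs, -, -, hfin⟩ :=
    Literature.FieldTheory.Separability.exists_finrank_frobenius_eq_pow_card (k := P) (K := M) p
  have hsn : s.card ≤ n := by
    have h1 := hs.cardinalMk_eq_trdeg
    rw [Cardinal.mk_coe_finset] at h1
    have h2 : (s.card : Cardinal) ≤ n := h1.le.trans htrM
    exact_mod_cast h2
  -- `v` inside `M` is `M^p`-free
  let vM : Fin m → M := fun j => ⟨v j, IntermediateField.subset_adjoin P _ (Or.inr ⟨j, rfl⟩)⟩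
  have hvM : LinearIndependent (frobenius M p).fieldRange vM := by
    rw [Fintype.linearIndependent_iff] at hv ⊢
    intro g hg j
    have hgK : ∀ i, ((g i : M) : K) ∈ (frobenius K p).fieldRange := fun i => by
      obtain ⟨y, hy⟩ := RingHom.mem_fieldRange.mp (g i).2
      exact RingHom.mem_fieldRange.mpr ⟨(y : K), by
        rw [frobenius_def, ← hy, frobenius_def]; rfl⟩
    have h := hv (fun i => ⟨((g i : M) : K), hgK i⟩) (by
      have h0 := congrArg (algebraMap M K) hg
      rw [map_sum, map_zero] at h0
      rw [← h0]
      refine Finset.sum_congr rfl fun i _ => ?_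
      simp only [Subfield.smul_def, smul_eq_mul, map_mul]
      rfl) j
    have h' : ((g j : M) : K) = 0 := congrArg Subtype.val h
    exact Subtype.ext (Subtype.ext (by rw [h']; rfl))
  haveI : Module.Finite (frobenius M p).fieldRange M :=
    Module.finite_of_finrank_pos (by rw [hfin]; exact pow_pos hp.pos _)
  have hcard := hvM.fintype_card_le_finrank
  rw [Fintype.card_fin, hfin] at hcard
  exact hcard.trans (Nat.pow_le_pow_right hp.pos hsn)

end Summit.ResolutionOfSingularities.ResolutionOfSingularities.Theorems

end
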